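/-
Origin: expansion seat `planner-pub-hodgecm-pv13-g3-0`, handover #7 2026-08-18T07:24:01Z (`HOME/pub-hodgecm-pv13-g3/lean/Pv13g3/PlaceInputs.lean`, md5 e033a264, 208 lines);
landed by the gen-7 packager in gate run 26 as `HodgeCM/PerL34/PlaceInputs.lean` (import ^import Pv13g3\.→import HodgeCM.PerL34. ×1).
-/
/-
Copyright: HodgeCM publication cell (pub-hodgecm), DAG node N31h (seam S3) — the four per-place INPUTS of every S3 end
theorem, BY NAME, over the completions.  Prover seat pv13-g3 (DAG-NODE PROVER #13, generation 3), file #7.  Released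
under the package licence.

# The per-place inputs `X`, `hclS`, `ram_pos`, `hsum` of the S3 end theorems — produced by name

Every end theorem of seam S3 in the package — pv09-g3 `PureTensor.theta_ne_zero_haar` (HaarPieces; finite-volume
`𝓕`), `PureTensor.theta_ne_zero_local(_of_places)` (OrbitContinuity), `PureTensor.theta_ne_zero_levels_of_places`
(CharContinuity), and downstream pv09-g4's `RallisHaar.theta_ne_zero_rallis` / `theta_ne_zero_of_N31d` /
`thetaLift_ne_zero_of_N31d` (queued) — takes the same four PER-PLACE inputs:
  `X : UnramifiedPlaceData B (haarDatum B hBc hBo S₀) ω φ χ S q chiPi nuPi IsSplit` (tex ll. 624–631),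
  `hclS : ∀ i ∈ S, Integrable (localCoeff B ω φ i) (ν_i)` (l. 629–630),
  `ram_pos : ∀ i ∈ S, 0 < I_i` (ll. 612–623),
  `hsum : Σ_{v∉S} q_v^{-3/2} < ∞` (l. 631–632).
Files #2a–#6 of this seat discharged them INSIDE the end theorems `theta_ne_zero_levels_adic*`.  This file exposes the
four as NAMED PRODUCERS over the completions `L_{0,v} = (w v).adicCompletion L₀`, so that ANY consumer (in particular
the N31d ⟹ N31e ⟹ θ ≠ 0 chain of pv09-g4, once landed) can plug them in without re-deriving:
* `adicModel` / `adicPlaceData` — `X` with `q_v := resIndex ϖF_v` (`= N(w v)` off `S`: `adic_q_eq_absNorm`),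
  `chiPi_v := χ′(ι_v ϖ_v)`, `nuPi_v := ν_v(ϖF_v)`, from the split-unramified dictionary data (D4) and `hBi`;
* `summable_tOf_adic` — `hsum` from the injectivity of `w` off `S` (pv13 `EulerProduct.summable_tOf_of_places`);
* `integrable_localCoeff_S_adic` — `hclS` at EVERY place of `S`: split places from #5 (`τ_v`, ball, dictionary),
  non-split places from #6 (compactness);
* `I_pos_S_adic` — `ram_pos` at EVERY place of `S`: split places from #5, non-split places from #6 (isotypy);
* `theta_ne_zero_haar_adic` — CHECK OF FIT: pv09-g3's most general end theorem `theta_ne_zero_haar` (fundamental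
  domain `𝓕` of finite non-zero volume, no compactness) with the four inputs := the producers above; this also
  generalises #6's `theta_ne_zero_levels_adic_all` from a compact `𝓕` with interior to any `𝓕` with
  `0 < μ(𝓕) < ∞` (pv09-g4's `IsFundamentalDomain` setting).
Source under adjudication (NOT cited): PerL v5 Lemma 4.2(b) proof ll. 608–632 (quoted in #2a–#6).  Nothing cited,
nothing asserted; complete proofs; axioms = the standard trio (log in the handover).
-/
import Summits.HodgeConjecture.HodgeCM.PerL34.NonsplitRamified

noncomputable section

open MeasureTheory MeasureTheory.Measure Set Metric Function Complex ComplexConjugate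
open scoped RestrictedProduct InnerProductSpace NNReal ENNReal

namespace HodgeCM.PerL34.SplitShells

open HodgeCM.PerL34.PureTensor HodgeCM.PerL34.AdelicFactorisation HodgeCM.PerL34.RestrictedMeasure
open HodgeCM.PerL34.NoSmallSubgroups HodgeCM.PerL34.EulerFactorisation
open HodgeCM.PerL34.LocalFactors HodgeCM.PerL34.LocalFactors.DilationModel
open HodgeCM.PerL34.LocalModulus HodgeCM.PerL34.SplitPlaceDilation

attribute [local instance] LocalFactors.DilationModel.Adic.nontriviallyNormedField
  LocalFactors.DilationModel.Adic.properSpace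

section adicInputs

variable {ι : Type} {G : ι → Type} [∀ i, CommGroup (G i)] [∀ i, TopologicalSpace (G i)]
  [∀ i, IsTopologicalGroup (G i)] [∀ i, T2Space (G i)] [∀ i, SecondCountableTopology (G i)]
  [∀ i, LocallyCompactSpace (G i)] [∀ i, MeasurableSpace (G i)] [∀ i, BorelSpace (G i)]
  [Countable ι] [DecidableEq ι]
  (B : ∀ i, Subgroup (G i)) (hBc : ∀ i, IsCompact (B i : Set (G i)))
  (hBo : ∀ i, IsOpen (B i : Set (G i))) (S₀ : Finset ι)
  {Sp : Type} [NormedAddCommGroup Sp] [InnerProductSpace ℂ Sp]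
  (ω : (Πʳ j, [G j, B j]) →* (Sp ≃ₗᵢ[ℂ] Sp)) (φ : Sp) (χ : (Πʳ j, [G j, B j]) →* Circle)
  {S : Finset ι} {IsSplit : ι → Prop}
  (L₀ : Type) [Field L₀] [NumberField L₀]
  (w : ι → IsDedekindDomain.HeightOneSpectrum (NumberField.RingOfIntegers L₀))
  [∀ i, MeasurableSpace ((w i).adicCompletion L₀)] [∀ i, BorelSpace ((w i).adicCompletion L₀)]
  (ν : ∀ i, ((w i).adicCompletion L₀)ˣ →* Circle)

/-! ### `X` — the unramified place data -/

/-- **The split-place model at a split unramified place over the completion** (dictionary data ⟹ pv09-g3's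
six shell fields): `q_v := resIndex ϖF_v`, `χ′_v(ϖ_v)`, `ν_v(ϖF_v)`. -/
def adicModel (i : ι) (ord : G i →* Multiplicative ℤ) (ϖ : G i) (ϖF : ((w i).adicCompletion L₀)ˣ)
    (hϖF : IsUniformizer ϖF) (ord_ϖ : ord ϖ = Multiplicative.ofAdd 1) (ker_ord : ∀ g : G i, ord g = 1 ↔ g ∈ B i)
    (fixed : ∀ b : G i, b ∈ B i → ω (RestrictedProduct.mulSingle B i b) φ = φ)
    (unram : ∀ b : G i, b ∈ B i → χ (RestrictedProduct.mulSingle B i b) = 1)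
    (hν : ∀ u : ((w i).adicCompletion L₀)ˣ, ‖(u : (w i).adicCompletion L₀)‖ = 1 → ν i u = 1)
    (coeff_eq : ∀ n : ℤ, localCoeff B ω φ i (ϖ ^ n)
      = ⟪ballIndicator (Adic.muV L₀ (w i)) 0 1,
          dilationRep (Adic.muV L₀ (w i)) (ν i) (ϖF ^ n) (ballIndicator (Adic.muV L₀ (w i)) 0 1)⟫_ℂ) :
    SplitPlaceModel B (haarDatum B hBc hBo S₀) ω φ χ i (resIndex ϖF)
      (((χ (RestrictedProduct.mulSingle B i ϖ) : Circle) : ℂ)) (((ν i ϖF : Circle) : ℂ)) :=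
  splitPlaceModelOfDilation B (haarDatum B hBc hBo S₀) ω φ χ (Adic.muV L₀ (w i)) 1 (ν i) i ord ϖ ord_ϖ
    ker_ord (hBo i).measurableSet (haarDatum_ν_self B hBc hBo S₀ i) fixed unram ϖF hϖF.1 hν
    (Adic.muV_real_closedBall L₀ (w i)) coeff_eq

variable (hBi : ∀ i, i ∉ S → ¬IsSplit i → (B i : Set (G i)) = Set.univ)
  (ord : ∀ i, G i →* Multiplicative ℤ) (ϖ : ∀ i, G i) (ϖF : ∀ i, ((w i).adicCompletion L₀)ˣ)
  (hϖF : ∀ i, i ∉ S → IsUniformizer (ϖF i))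
  (ord_ϖ : ∀ i, i ∉ S → IsSplit i → ord i (ϖ i) = Multiplicative.ofAdd 1)
  (ker_ord : ∀ i, i ∉ S → IsSplit i → ∀ g : G i, ord i g = 1 ↔ g ∈ B i)
  (fixed : ∀ i, i ∉ S → IsSplit i → ∀ b : G i, b ∈ B i → ω (RestrictedProduct.mulSingle B i b) φ = φ)
  (unram : ∀ i, i ∉ S → IsSplit i → ∀ b : G i, b ∈ B i → χ (RestrictedProduct.mulSingle B i b) = 1)
  (hν : ∀ i, i ∉ S → IsSplit i → ∀ u : ((w i).adicCompletion L₀)ˣ,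
    ‖(u : (w i).adicCompletion L₀)‖ = 1 → ν i u = 1)
  (coeff_eq : ∀ i, i ∉ S → IsSplit i → ∀ n : ℤ, localCoeff B ω φ i (ϖ i ^ n)
    = ⟪ballIndicator (Adic.muV L₀ (w i)) 0 1,
        dilationRep (Adic.muV L₀ (w i)) (ν i) (ϖF i ^ n) (ballIndicator (Adic.muV L₀ (w i)) 0 1)⟫_ℂ)

/-- **`X` PRODUCED over the completions**: pv09-g3's `UnramifiedPlaceData` for the canonical Haar datum with
`q_v := resIndex ϖF_v`, from the split dictionary data and `hBi` (`hν1` is `haarDatum_ν_univ`, `2 ≤ q_v` is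
`two_le_resIndex`, `|χ′_v(ϖ_v)| = |ν_v(ϖF_v)| = 1`). -/
def adicPlaceData :
    UnramifiedPlaceData B (haarDatum B hBc hBo S₀) ω φ χ S (fun i => resIndex (ϖF i))
      (fun i => ((χ (RestrictedProduct.mulSingle B i (ϖ i)) : Circle) : ℂ))
      (fun i => ((ν i (ϖF i) : Circle) : ℂ)) IsSplit :=
  unramifiedPlaceDataOfModels B (haarDatum B hBc hBo S₀) ω φ χ
    (fun i hi hs => adicModel B hBc hBo S₀ ω φ χ L₀ w ν i (ord i) (ϖ i) (ϖF i) (hϖF i hi) (ord_ϖ i hi hs)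
      (ker_ord i hi hs) (fixed i hi hs) (unram i hi hs) (hν i hi hs) (coeff_eq i hi hs))
    hBi (fun i hi hs => haarDatum_ν_univ B hBc hBo S₀ i (hBi i hi hs))
    (fun i hi => two_le_resIndex (hϖF i hi).1) (fun i _ => norm_chiPi B χ i (ϖ i))
    (fun i _ => norm_nuPi (ν i) (ϖF i))

omit [Countable ι] [DecidableEq ι] [∀ i, MeasurableSpace ((w i).adicCompletion L₀)]
  [∀ i, BorelSpace ((w i).adicCompletion L₀)] in
include hϖF in
/-- `q_v = N(v)` off `S` (pv07-g2 `Adic.resIndex_eq_absNorm`). -/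
theorem adic_q_eq_absNorm (j : {j : ι // j ∉ S}) :
    resIndex (ϖF j.1) = Ideal.absNorm (w j.1).asIdeal :=
  Adic.resIndex_eq_absNorm L₀ (w j.1) (ϖF j.1) (hϖF j.1 j.2)

/-! ### `hsum` -/

omit [Countable ι] [DecidableEq ι] [∀ i, MeasurableSpace ((w i).adicCompletion L₀)]
  [∀ i, BorelSpace ((w i).adicCompletion L₀)] in
include hϖF in
/-- **`hsum` PRODUCED**: `Σ_{v∉S} q_v^{-3/2} < ∞` for `q_v := resIndex ϖF_v = N(w v)`, `w` injective off `S`. -/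
theorem summable_tOf_adic (hw : ∀ ⦃i j : ι⦄, i ∉ S → j ∉ S → w i = w j → i = j) :
    Summable fun j : {j : ι // j ∉ S} => EulerProduct.tOf (resIndex (ϖF j.1)) :=
  EulerProduct.summable_tOf_of_places (q := fun i => resIndex (ϖF i)) L₀ (fun j => w j.1)
    (fun j j' h => Subtype.ext (hw j.2 j'.2 h)) (adic_q_eq_absNorm L₀ w ϖF hϖF)

/-! ### `hclS` and `ram_pos` at every place of `S` -/

variable (τ : ∀ i, i ∈ S → IsSplit i → (G i ≃ₜ* ((w i).adicCompletion L₀)ˣ))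
  (x₀ : ∀ i, Fin 3 → (w i).adicCompletion L₀) (r cS : ι → ℝ)
  (hr : ∀ i ∈ S, IsSplit i → r i < ‖x₀ i‖) (hr0 : ∀ i ∈ S, IsSplit i → 0 < r i)
  (hνS : ∀ i ∈ S, IsSplit i → ∀ y : ((w i).adicCompletion L₀)ˣ,
    (y : (w i).adicCompletion L₀) ∈ U1 (x₀ i) (r i) → ν i y = 1)
  (coeffS : ∀ i (hi : i ∈ S) (hs : IsSplit i), ∀ g : G i, localCoeff B ω φ i g
    = (cS i : ℂ) * ⟪ballIndicator (Adic.muV L₀ (w i)) (x₀ i) (r i),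
        dilationRep (Adic.muV L₀ (w i)) (ν i) (τ i hi hs g) (ballIndicator (Adic.muV L₀ (w i)) (x₀ i) (r i))⟫_ℂ)
  (hcpt : ∀ i ∈ S, ¬IsSplit i → CompactSpace (G i))
  (hloc : ∀ (i : ι) (v : Sp), Continuous fun g : G i => ω (RestrictedProduct.mulSingle B i g) v)

omit [∀ i, LocallyCompactSpace (G i)] in
include hr hr0 hνS coeffS hcpt hloc in
/-- **`hclS` PRODUCED at every place of `S`** (split: #5 `integrable_localCoeff_of_splitDict`; non-split: #6
`integrable_localCoeff_of_compactSpace`). -/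
theorem integrable_localCoeff_S_adic (i : ι) (hi : i ∈ S) :
    Integrable (localCoeff B ω φ i) ((haarDatum B hBc hBo S₀).ν i) := by
  by_cases hs : IsSplit i
  · exact integrable_localCoeff_of_splitDict B hBc hBo S₀ ω φ (Adic.muV L₀ (w i)) (ν i) (x₀ i) (r i) i
      (τ i hi hs) (hr i hi hs) (hr0 i hi hs) (cS i) (hνS i hi hs) (coeffS i hi hs)
  · haveI := hcpt i hi hs
    exact integrable_localCoeff_of_compactSpace B hBc hBo S₀ ω φ i (hloc i φ)

variable (hφ : ‖φ‖ = 1) (hcS : ∀ i ∈ S, IsSplit i → 0 < cS i)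
  (hχS : ∀ i (hi : i ∈ S) (hs : IsSplit i), ∀ g : G i,
    ((τ i hi hs g : ((w i).adicCompletion L₀)ˣ) : (w i).adicCompletion L₀) ∈ U1 (x₀ i) (r i) →
      χ (RestrictedProduct.mulSingle B i g) = 1)
  (hiso : ∀ i ∈ S, ¬IsSplit i → ∀ g : G i, ω (RestrictedProduct.mulSingle B i g) φ
    = conj (((χ (RestrictedProduct.mulSingle B i g) : Circle) : ℂ)) • φ)

include hr hr0 hνS coeffS hcpt hφ hcS hχS hiso in
/-- **`ram_pos` PRODUCED at every place of `S`** (split: #5 `I_pos_of_splitDict`; non-split: #6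
`I_pos_of_isotypic`). -/
theorem I_pos_S_adic (i : ι) (hi : i ∈ S) :
    0 < (localIntegrand B (haarDatum B hBc hBo S₀) ω φ χ i).I := by
  by_cases hs : IsSplit i
  · exact I_pos_of_splitDict B hBc hBo S₀ ω φ χ (Adic.muV L₀ (w i)) (ν i) (x₀ i) (r i) i (τ i hi hs)
      (hr i hi hs) (hr0 i hi hs) (cS i) (hcS i hi hs) (hνS i hi hs) (hχS i hi hs) (coeffS i hi hs)
  · haveI := hcpt i hi hs
    exact I_pos_of_isotypic B hBc hBo S₀ ω φ χ i hφ (hiso i hi hs)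

/-! ### Check of fit: pv09-g3's most general end theorem with the four inputs produced -/

variable {E : Type*} [NormedAddCommGroup E] [InnerProductSpace ℂ E]
  {T' : Finset ι} (hχT' : RestrictedProduct.boxSubgroup B T' ≤ χ.ker)
  (hlocχ : ∀ i ∈ T', Continuous fun g : G i => χ (RestrictedProduct.mulSingle B i g))
  (𝓕 : Set (Πʳ j, [G j, B j])) (K : (Πʳ j, [G j, B j]) → (Πʳ j, [G j, B j]) → ℂ) (c : ℝ)
  (c_pos : 0 < c) (vol_ne_zero : (haarDatum B hBc hBo S₀).μ 𝓕 ≠ 0)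
  (vol_ne_top : (haarDatum B hBc hBo S₀).μ 𝓕 ≠ ⊤) (θ : E) (Θ : Set E) (hθ : θ ∈ Θ)
  (hN31e : RallisIP.N31e_statement (haarDatum B hBc hBo S₀).μ 𝓕 ω φ
    (fun y => ((χ y : Circle) : ℂ)) K (c : ℂ))
  (hnorm : ⟪θ, θ⟫_ℂ = ∫ u in 𝓕, ∫ u' in 𝓕, ((χ u : Circle) : ℂ) * conj ((χ u' : Circle) : ℂ) *
    K u u' ∂(haarDatum B hBc hBo S₀).μ ∂(haarDatum B hBc hBo S₀).μ)
  {T : Finset ι} (hK : ∀ k ∈ RestrictedProduct.boxSubgroup B T, ω k φ = φ)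
  (hM : ∀ S : Finset ι, T ⊆ S → ∀ y : (i : ↥S) → G i,
    inner ℂ φ (ω (extendOne B S y) φ) = ∏ i : ↥S, localCoeff B ω φ i (y i))
  (hTS : T ⊆ S) (hT'S : T' ⊆ S)
  (hw : ∀ ⦃i j : ι⦄, i ∉ S → j ∉ S → w i = w j → i = j)

include hBi hϖF ord_ϖ ker_ord fixed unram hν coeff_eq hr hr0 hνS coeffS hcpt hloc hφ hcS hχS hiso hχT' hlocχ
  c_pos vol_ne_zero vol_ne_top hθ hN31e hnorm hK hM hTS hT'S hw in
/-- **`θ ≠ 0` for a fundamental domain `𝓕` of finite non-zero volume** (pv09-g3 `theta_ne_zero_haar`, no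
compactness of `𝓕`), levels and LOCAL continuity, over the completions, with `X`, `hclS`, `ram_pos`, `hsum`
PRODUCED by this file — the per-place hypotheses are exactly those of #6's `theta_ne_zero_levels_adic_all`. -/
theorem theta_ne_zero_haar_adic : θ ≠ 0 := by
  classical
  exact theta_ne_zero_haar B hBc hBo S₀ ω φ hφ (continuous_orbit B ω φ hK hloc) χ
    (continuous_char B hBo χ hχT' hlocχ) 𝓕 K c c_pos vol_ne_zero vol_ne_top θ Θ hθ hN31e hnorm hK hχT' hM
    (adicPlaceData B hBc hBo S₀ ω φ χ L₀ w ν hBi ord ϖ ϖF hϖF ord_ϖ ker_ord fixed unram hν coeff_eq) hTS hT'S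
    (integrable_localCoeff_S_adic B hBc hBo S₀ ω φ L₀ w ν τ x₀ r cS hr hr0 hνS coeffS hcpt hloc)
    (I_pos_S_adic B hBc hBo S₀ ω φ χ L₀ w ν τ x₀ r cS hr hr0 hνS coeffS hcpt hφ hcS hχS hiso)
    (summable_tOf_adic L₀ w ϖF hϖF hw)

end adicInputs

end HodgeCM.PerL34.SplitShells

end
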